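import Summits.CriticalPhenomena.PercolationContinuityZ3.Theorems.PercNearOneGluingNoHeavyQuantIncomeCriterion
import Summits.CriticalPhenomena.PercolationContinuityZ3.Theorems.PercNearOneGluingNoHeavyQuantMixedShift
import HarnessLib

/-!
# QUANT lane R8, T-DEC, leg (III): POOLED OFFERS — the offers criterion of the income criterion is LINEAR in (law, routing), so two laws at
# a COMMON target whose zero atoms are jointly affordable mix to a DEC law; the SEPARABLE CERTIFICATE for `MixedShiftDEC`

builds on p205010 (kernel theorem, internal audit signed; external expert review pending)

Support file (`--supports stmt-CriticalPhenomena-4575`), QUANT lane lead seat prim-quant-lead (gen 29), rung R8 of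
`run/shared/lean/prim/quant/LADDER.md`.  Theorems only, standard axioms, no sorries.  Continues arm-1 g39's `…QuantIncomeCriterion`
(`flowAtT_of_offers`: DEC ⟸ a capacity-feasible routing of the NONZERO lows + ONE inequality "the zero atom fits into the priced leftovers")
and lead g29's `…QuantMixedShift` (`MixedShiftDEC`, `shiftBut`).

THE POINT (lead g29, LEAD-NOTES-G29 N98).  In arm-1's offers criterion the data (law `A`, routing `φ` of its nonzero lows) enter LINEARLY:
row sums, column loads and the OFFER `Σ_h w_h·(A h − load_h)` (`w_h = T(1−x)/x` on giants, `h − T` on mids above `T`) are affine in `(A, φ)`,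
and the support / top-affordability side conditions depend only on the positions and the common `(x, T, j′, M)`.  Hence (`flowAtT_mix_of_offers`):
two laws `A₁`, `A₂` at the SAME floor, target, layer and top, each with a capacity-feasible routing of its own nonzero lows, mix to a law
`θA₁ + (1−θ)A₂` that is DEC as soon as the POOLED offer pays for the pooled zero atom:
`T·(θ·A₁ 0 + (1−θ)·A₂ 0) ≤ θ·OFFER(A₁, φ₁) + (1−θ)·OFFER(A₂, φ₂)` — one law may be short (its own zero atom not affordable at `T`) if the other
has the matching surplus.  This is the law-level form of lead g28's one-budget certificate (Σ λ_r·zcap_r ≥ p) and of arm-1 g38's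
reassembly, free of any piece shape.

THE SEPARABLE CERTIFICATE FOR `MixedShiftDEC` (`mixedShift_of_offers`).  The conclusion law of `MixedShiftDEC` is the mixture
`(1−g)·ν + g·W`, `W = shiftBut ν a z`, at the common target `t = S + ag(1−z)`; so a routing `χ` of `ν`'s nonzero lows AT TARGET `t` and a
routing `ψ` of `W`'s nonzero lows AT TARGET `t` with `t·((1−g)·ν 0 + g·z) ≤ (1−g)·OFFER(ν, χ) + g·OFFER(W, ψ)` prove the conclusion — W's GAIN
from its lowered target (`t ≤ S + a(1−z)`) pays ν's LOSS from its raised target (`t ≥ S`).  EXACT CENSUS (lead g29 `explore/g11_income.py`,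
`g12_ineqs.py`; both regimes, boundary-pushed): with the OPTIMAL routings on each side the pooled inequality holds in 1 134 / 1 134 + 500 / 500
of the instances in which both laws CAN route their nonzero lows at `t` (≈ 85 % of all instances); the remaining ≈ 15 % need a cross-copy
routing (a nonzero low of one copy into an absorber of the other; N96) and are not covered by this file.  Neither theorem here is conditional
on any conjecture.

* `LawDec.offerOf x T j′ M A φ` — the offer `Σ_{h ≤ M} w_h·(A h − Σ_l usage·φ l h)` of a routing.
* **`LawDec.flowAtT_mix_of_offers`** / `LawDec.decAtT_mix_of_offers` — pooled offers criterion for a two-law mixture at a common target.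
* **`LawDec.mixedShift_of_offers`** — the separable certificate: `MixedShiftDEC`'s conclusion from one routing per copy at the common
  target and the pooled offer inequality (unconditional).

HONEST STATUS: `MixedShiftDEC` itself remains OPEN (this certifies its separable regime instance-wise); `GateMove`, `GatedConvEmptyFree`,
`SDECConvClosed`, `SingleGateConvClosed`, `TreeDEC`, `FarTreeRow` OPEN; the RATE class log\* and the honest sentence of
`run/shared/lean/prim/quant/README.md` are unchanged.

[this work]; the offers / income criterion: prim-quant-arm-1 g39 (this lane).  Nothing here is cited as a published result.  The gluing rows
served [cite: KozmaNitzan2024, Conjecture 3 (p. 15)]; product measure [cite: Grimmett1999, §1.3 p. 10].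
-/

noncomputable section

namespace Summit.CriticalPhenomena.PercolationContinuityZ3.Theorems

namespace Quant

open Finset

namespace LawDec

/-- **the OFFER of a routing `φ`** of the nonzero lows of `A` at `(x, T, j′)` on `{0..M}`: every giant `h ≥ j′+1` offers `T(1−x)/x` and every
mid `h > T` offers `h − T` per unit of its capacity left over by `φ` (arm-1 g39's `flowAtT_of_offers`, right-hand side). [this work] -/
def offerOf (x T : ℝ) (j' M : ℕ) (A : ℕ → ℝ) (φ : ℕ → ℕ → ℝ) : ℝ :=
  ∑ h ∈ Finset.range (M + 1),
    (if j' + 1 ≤ h then T * (1 - x) / x else if T < (h : ℝ) then (h : ℝ) - T else 0)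
      * (A h - ∑ l ∈ Finset.range (j' + 1), usage x T j' l h * φ l h)

/-- **POOLED OFFERS CRITERION (two laws, common target).**  `0 < x < 1`, `0 < T`, `0 ≤ θ ≤ 1`; `A₁, A₂ ≥ 0`; mids above `T` top-affordable
(`x·h ≤ T` for `h ≤ j′`, `h ≤ M`, `h > T`); `φᵢ` a routing of the NONZERO lows of `Aᵢ` (supported on allowed pairs, shipping every nonzero low
exactly, loading every absorber by at most its mass).  If the pooled offer pays for the pooled zero atom,
`T·(θ·A₁ 0 + (1−θ)·A₂ 0) ≤ θ·offerOf A₁ φ₁ + (1−θ)·offerOf A₂ φ₂`, then `θA₁ + (1−θ)A₂` admits a flow at `(x, T, j′)` on `{0..M}`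
(arm-1's `flowAtT_of_offers` for the mixed routing `θφ₁ + (1−θ)φ₂`; everything is affine). [this work] -/
theorem flowAtT_mix_of_offers (x T θ : ℝ) (j' M : ℕ) (A₁ A₂ : ℕ → ℝ) (φ₁ φ₂ : ℕ → ℕ → ℝ)
    (hx0 : 0 < x) (hx1 : x < 1) (hT : 0 < T) (hθ0 : 0 ≤ θ) (hθ1 : θ ≤ 1)
    (hA₁ : ∀ h, 0 ≤ A₁ h) (hA₂ : ∀ h, 0 ≤ A₂ h)
    (hta : ∀ h : ℕ, h ≤ j' → h ≤ M → T < (h : ℝ) → x * (h : ℝ) ≤ T)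
    (hφ₁0 : ∀ l h, 0 ≤ φ₁ l h)
    (hφ₁supp : ∀ l h, 0 < φ₁ l h → (1 ≤ l ∧ l ≤ j' ∧ 2 * (l : ℝ) < T) ∧ h ≤ M ∧ (j' + 1 ≤ h ∨ T < (l : ℝ) + h))
    (hφ₁row : ∀ l : ℕ, 1 ≤ l → l ≤ j' → 2 * (l : ℝ) < T → ∑ h ∈ Finset.range (M + 1), φ₁ l h = A₁ l)
    (hφ₁col : ∀ h, h ≤ M → (j' + 1 ≤ h ∨ T ≤ 2 * (h : ℝ)) → ∑ l ∈ Finset.range (j' + 1), usage x T j' l h * φ₁ l h ≤ A₁ h)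
    (hφ₂0 : ∀ l h, 0 ≤ φ₂ l h)
    (hφ₂supp : ∀ l h, 0 < φ₂ l h → (1 ≤ l ∧ l ≤ j' ∧ 2 * (l : ℝ) < T) ∧ h ≤ M ∧ (j' + 1 ≤ h ∨ T < (l : ℝ) + h))
    (hφ₂row : ∀ l : ℕ, 1 ≤ l → l ≤ j' → 2 * (l : ℝ) < T → ∑ h ∈ Finset.range (M + 1), φ₂ l h = A₂ l)
    (hφ₂col : ∀ h, h ≤ M → (j' + 1 ≤ h ∨ T ≤ 2 * (h : ℝ)) → ∑ l ∈ Finset.range (j' + 1), usage x T j' l h * φ₂ l h ≤ A₂ h)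
    (hpool : T * (θ * A₁ 0 + (1 - θ) * A₂ 0) ≤ θ * offerOf x T j' M A₁ φ₁ + (1 - θ) * offerOf x T j' M A₂ φ₂) :
    FlowAtT x T j' M (fun h => θ * A₁ h + (1 - θ) * A₂ h) := by
  have h1θ : 0 ≤ 1 - θ := by linarith
  -- loads of the mixed routing are the mixed loads
  have hload : ∀ h, ∑ l ∈ Finset.range (j' + 1), usage x T j' l h * (θ * φ₁ l h + (1 - θ) * φ₂ l h)
      = θ * ∑ l ∈ Finset.range (j' + 1), usage x T j' l h * φ₁ l h
        + (1 - θ) * ∑ l ∈ Finset.range (j' + 1), usage x T j' l h * φ₂ l h := by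
    intro h
    rw [Finset.mul_sum, Finset.mul_sum, ← Finset.sum_add_distrib]
    exact Finset.sum_congr rfl fun l _ => by ring
  refine flowAtT_of_offers x T j' M (fun h => θ * A₁ h + (1 - θ) * A₂ h) (fun l h => θ * φ₁ l h + (1 - θ) * φ₂ l h)
    hx0 hx1 hT (fun h => by nlinarith [hA₁ h, hA₂ h]) hta (fun l h => by nlinarith [hφ₁0 l h, hφ₂0 l h]) ?_ ?_ ?_ ?_
  · -- support: a positive mixed entry has a positive summand
    intro l h hpos
    by_cases h1 : 0 < φ₁ l h
    · exact hφ₁supp l h h1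
    · have h1' : φ₁ l h = 0 := le_antisymm (not_lt.1 h1) (hφ₁0 l h)
      have h2 : 0 < φ₂ l h := by
        by_contra hc
        have h2' : φ₂ l h = 0 := le_antisymm (not_lt.1 hc) (hφ₂0 l h)
        rw [h1', h2', mul_zero, mul_zero, add_zero] at hpos
        exact lt_irrefl _ hpos
      exact hφ₂supp l h h2
  · -- rows
    intro l hl1 hlj hlow
    rw [Finset.sum_add_distrib, ← Finset.mul_sum, ← Finset.mul_sum, hφ₁row l hl1 hlj hlow, hφ₂row l hl1 hlj hlow]
  · -- columns
    intro h hhM habs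
    rw [hload h]
    nlinarith [hφ₁col h hhM habs, hφ₂col h hhM habs]
  · -- the pooled offer
    have e : ∑ h ∈ Finset.range (M + 1),
        (if j' + 1 ≤ h then T * (1 - x) / x else if T < (h : ℝ) then (h : ℝ) - T else 0)
          * ((θ * A₁ h + (1 - θ) * A₂ h) - ∑ l ∈ Finset.range (j' + 1), usage x T j' l h * (θ * φ₁ l h + (1 - θ) * φ₂ l h))
        = θ * offerOf x T j' M A₁ φ₁ + (1 - θ) * offerOf x T j' M A₂ φ₂ := by
      simp only [offerOf, Finset.mul_sum, ← Finset.sum_add_distrib]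
      refine Finset.sum_congr rfl fun h _ => ?_
      rw [hload h]
      ring
    show T * (θ * A₁ 0 + (1 - θ) * A₂ 0) ≤ _
    rw [e]
    exact hpool

/-- **POOLED OFFERS CRITERION, DEC form**: as `flowAtT_mix_of_offers`, for probability laws `A₁, A₂` on `{0..M}` (then the mixture is a
probability law on `{0..M}` and `decAtT_of_flowAtT` applies). [this work] -/
theorem decAtT_mix_of_offers (x T θ : ℝ) (j' M : ℕ) (A₁ A₂ : ℕ → ℝ) (φ₁ φ₂ : ℕ → ℕ → ℝ)
    (hx0 : 0 < x) (hx1 : x < 1) (hT : 0 < T) (hθ0 : 0 ≤ θ) (hθ1 : θ ≤ 1)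
    (hA₁ : ∀ h, 0 ≤ A₁ h) (hA₁M : ∀ h, M < h → A₁ h = 0) (hA₁1 : ∑ h ∈ Finset.range (M + 1), A₁ h = 1)
    (hA₂ : ∀ h, 0 ≤ A₂ h) (hA₂M : ∀ h, M < h → A₂ h = 0) (hA₂1 : ∑ h ∈ Finset.range (M + 1), A₂ h = 1)
    (hta : ∀ h : ℕ, h ≤ j' → h ≤ M → T < (h : ℝ) → x * (h : ℝ) ≤ T)
    (hφ₁0 : ∀ l h, 0 ≤ φ₁ l h)
    (hφ₁supp : ∀ l h, 0 < φ₁ l h → (1 ≤ l ∧ l ≤ j' ∧ 2 * (l : ℝ) < T) ∧ h ≤ M ∧ (j' + 1 ≤ h ∨ T < (l : ℝ) + h))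
    (hφ₁row : ∀ l : ℕ, 1 ≤ l → l ≤ j' → 2 * (l : ℝ) < T → ∑ h ∈ Finset.range (M + 1), φ₁ l h = A₁ l)
    (hφ₁col : ∀ h, h ≤ M → (j' + 1 ≤ h ∨ T ≤ 2 * (h : ℝ)) → ∑ l ∈ Finset.range (j' + 1), usage x T j' l h * φ₁ l h ≤ A₁ h)
    (hφ₂0 : ∀ l h, 0 ≤ φ₂ l h)
    (hφ₂supp : ∀ l h, 0 < φ₂ l h → (1 ≤ l ∧ l ≤ j' ∧ 2 * (l : ℝ) < T) ∧ h ≤ M ∧ (j' + 1 ≤ h ∨ T < (l : ℝ) + h))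
    (hφ₂row : ∀ l : ℕ, 1 ≤ l → l ≤ j' → 2 * (l : ℝ) < T → ∑ h ∈ Finset.range (M + 1), φ₂ l h = A₂ l)
    (hφ₂col : ∀ h, h ≤ M → (j' + 1 ≤ h ∨ T ≤ 2 * (h : ℝ)) → ∑ l ∈ Finset.range (j' + 1), usage x T j' l h * φ₂ l h ≤ A₂ h)
    (hpool : T * (θ * A₁ 0 + (1 - θ) * A₂ 0) ≤ θ * offerOf x T j' M A₁ φ₁ + (1 - θ) * offerOf x T j' M A₂ φ₂) :
    DECAtT x T j' M (fun h => θ * A₁ h + (1 - θ) * A₂ h) := by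
  refine decAtT_of_flowAtT x T j' M _ hx0 hx1 (fun h hh => by simp only [hA₁M h hh, hA₂M h hh]; ring) ?_
    (flowAtT_mix_of_offers x T θ j' M A₁ A₂ φ₁ φ₂ hx0 hx1 hT hθ0 hθ1 hA₁ hA₂ hta hφ₁0 hφ₁supp hφ₁row hφ₁col hφ₂0 hφ₂supp
      hφ₂row hφ₂col hpool)
  rw [Finset.sum_add_distrib, ← Finset.mul_sum, ← Finset.mul_sum, hA₁1, hA₂1]; ring

/-! ### The separable certificate for `MixedShiftDEC` -/

/-- **THE SEPARABLE CERTIFICATE FOR `MixedShiftDEC` (unconditional).**  With the data of `MixedShiftDEC` (`0 < y < 1`, `0 ≤ z ≤ ν 0`,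
`g ≤ 1`, `y ≤ (1−z)g`, `1 ≤ a`, `ν` a probability law on `{0..M}`, a real `S > 0` with `y·M ≤ S` — in `MixedShiftDEC` the mean) and the common target
`t = S + a·g·(1−z)`: if `χ` routes the nonzero lows of `ν` AT `(y, t, j)` and `ψ` routes the nonzero lows of `W = shiftBut ν a z` AT
`(y, t, j)` (both on `{0..M+a}`, capacity-feasible), and the pooled offer pays for the zero atom,
`t·((1−g)·ν 0 + g·z) ≤ (1−g)·offerOf ν χ + g·offerOf W ψ` (W's gain from its lowered target pays ν's loss from its raised one), then the
mixture `(1−g)ν + gW` is DEC at `(y, t, j)` — the conclusion of `MixedShiftDEC`, with no conjecture.  (Mids above `t` are top-affordable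
because `y·(M+a) ≤ S + a·g·(1−z) = t`.)  Census: covers ≈ 85 % of the boundary-pushed instances (all those in which each copy can route
its own nonzero lows at `t`), 1 634 / 1 634 of them. [this work] -/
theorem mixedShift_of_offers (y z g S : ℝ) (a j M : ℕ) (ν : ℕ → ℝ) (χ ψ : ℕ → ℕ → ℝ)
    (hy0 : 0 < y) (hy1 : y < 1) (hz0 : 0 ≤ z) (hzν : z ≤ ν 0) (hg1 : g ≤ 1) (hyg : y ≤ (1 - z) * g) (ha : 1 ≤ a)
    (hν0 : ∀ h, 0 ≤ ν h) (hνM : ∀ h, M < h → ν h = 0) (hν1 : ∑ h ∈ Finset.range (M + 1), ν h = 1)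
    (hS0 : 0 < S) (hta : y * (M : ℝ) ≤ S)
    (hχ0 : ∀ l h, 0 ≤ χ l h)
    (hχsupp : ∀ l h, 0 < χ l h → (1 ≤ l ∧ l ≤ j ∧ 2 * (l : ℝ) < S + (a : ℝ) * g * (1 - z)) ∧ h ≤ M + a ∧
      (j + 1 ≤ h ∨ S + (a : ℝ) * g * (1 - z) < (l : ℝ) + h))
    (hχrow : ∀ l : ℕ, 1 ≤ l → l ≤ j → 2 * (l : ℝ) < S + (a : ℝ) * g * (1 - z) → ∑ h ∈ Finset.range (M + a + 1), χ l h = ν l)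
    (hχcol : ∀ h, h ≤ M + a → (j + 1 ≤ h ∨ S + (a : ℝ) * g * (1 - z) ≤ 2 * (h : ℝ)) →
      ∑ l ∈ Finset.range (j + 1), usage y (S + (a : ℝ) * g * (1 - z)) j l h * χ l h ≤ ν h)
    (hψ0 : ∀ l h, 0 ≤ ψ l h)
    (hψsupp : ∀ l h, 0 < ψ l h → (1 ≤ l ∧ l ≤ j ∧ 2 * (l : ℝ) < S + (a : ℝ) * g * (1 - z)) ∧ h ≤ M + a ∧
      (j + 1 ≤ h ∨ S + (a : ℝ) * g * (1 - z) < (l : ℝ) + h))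
    (hψrow : ∀ l : ℕ, 1 ≤ l → l ≤ j → 2 * (l : ℝ) < S + (a : ℝ) * g * (1 - z) →
      ∑ h ∈ Finset.range (M + a + 1), ψ l h = shiftBut ν a z l)
    (hψcol : ∀ h, h ≤ M + a → (j + 1 ≤ h ∨ S + (a : ℝ) * g * (1 - z) ≤ 2 * (h : ℝ)) →
      ∑ l ∈ Finset.range (j + 1), usage y (S + (a : ℝ) * g * (1 - z)) j l h * ψ l h ≤ shiftBut ν a z h)
    (hpool : (S + (a : ℝ) * g * (1 - z)) * ((1 - g) * ν 0 + g * z)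
      ≤ (1 - g) * offerOf y (S + (a : ℝ) * g * (1 - z)) j (M + a) ν χ
        + g * offerOf y (S + (a : ℝ) * g * (1 - z)) j (M + a) (shiftBut ν a z) ψ) :
    DECAtT y (S + (a : ℝ) * g * (1 - z)) j (M + a) (fun h => (1 - g) * ν h + g * shiftBut ν a z h) := by
  obtain ⟨w0, wM, w1, -⟩ := shiftBut_laws ν a M z ha hz0 hzν hν0 hνM hν1
  have hν01 : ν 0 ≤ 1 := by
    have h01 := Finset.single_le_sum (f := ν) (fun h _ => hν0 h) (Finset.mem_range.2 (Nat.succ_pos M))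
    rwa [hν1] at h01
  have hg0 : 0 ≤ g := by
    by_contra hc
    have hng : (1 - z) * g ≤ 0 := mul_nonpos_of_nonneg_of_nonpos (by linarith) (le_of_lt (not_le.1 hc))
    linarith
  have ha0 : (0 : ℝ) ≤ a := by exact_mod_cast (Nat.zero_le a)
  have ht0 : 0 < S + (a : ℝ) * g * (1 - z) := by
    have : 0 ≤ (a : ℝ) * g * (1 - z) := mul_nonneg (mul_nonneg ha0 hg0) (by linarith)
    linarith
  have hνM' : ∀ h, M + a < h → ν h = 0 := fun h hh => hνM h (by omega)
  have hν1' : ∑ h ∈ Finset.range (M + a + 1), ν h = 1 := by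
    rw [← Finset.sum_range_add_sum_Ico ν (show M + 1 ≤ M + a + 1 by omega), hν1,
      Finset.sum_eq_zero (fun h hh => hνM h (by have := (Finset.mem_Ico.1 hh).1; omega)), add_zero]
  -- top-affordability of the mids above the target: `y·h ≤ y·(M+a) ≤ S + a·g·(1−z)`
  have hta' : ∀ h : ℕ, h ≤ j → h ≤ M + a → S + (a : ℝ) * g * (1 - z) < (h : ℝ) → y * (h : ℝ) ≤ S + (a : ℝ) * g * (1 - z) := by
    intro h _ hhM _
    have h1 : y * (h : ℝ) ≤ y * ((M + a : ℕ) : ℝ) := mul_le_mul_of_nonneg_left (by exact_mod_cast hhM) hy0.le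
    have h2 : y * (a : ℝ) ≤ (1 - z) * g * a := mul_le_mul_of_nonneg_right hyg ha0
    push_cast at h1
    nlinarith
  have e0 : shiftBut ν a z 0 = z := by
    have h1 : ¬ a ≤ 0 := by omega
    have h2 : (0 : ℕ) ≠ a := by omega
    simp [shiftBut, h1, h2]
  rw [show (1 - g) * ν 0 + g * z = (1 - g) * ν 0 + g * shiftBut ν a z 0 by rw [e0]] at hpool
  have hmix := decAtT_mix_of_offers y (S + (a : ℝ) * g * (1 - z)) (1 - g) j (M + a) ν (shiftBut ν a z) χ ψ hy0 hy1 ht0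
    (by linarith) (by linarith) hν0 hνM' hν1' w0 wM w1 hta' hχ0 hχsupp hχrow hχcol hψ0 hψsupp hψrow hψcol
    (by convert hpool using 2 <;> ring)
  convert hmix using 2 with h
  ring

end LawDec

end Quant

end Summit.CriticalPhenomena.PercolationContinuityZ3.Theorems
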